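import Summits.HubbardSuperconductivity.HubbardSuperconductivity.Theorems.BalabanIRBirGappedPhaseReductionTorusZeroModeClosedForm
import Summits.HubbardSuperconductivity.HubbardSuperconductivity.Theorems.BalabanIRBirGappedPhaseReductionTraceHolder
import HarnessLib

/-!
# Route BalabanIR — crux 4 `BirGappedPhaseReduction` / 4R (items `stmt-HubbardSuperconductivity-2082`, `…-14846`):
# the diamagnetic inequality for global pair-phase histories (any background, any volume)

Complement to the torus results (`…TorusZeroModeCoercivity`, `…TorusZeroModeClosedForm`, which
QUANTIFY the loss): in complete generality — any finite Jordan–Wigner site set `Λ`, any Hermitian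
hopping `τ`, ANY pairing matrix `Δ` (textured or not), `μ`, step `a` — a history of GLOBAL pair
phases `θ_t` over a dyadic number `M = 2^{k+1}` of imaginary-time slices never weighs more than the
aligned history:

* `trace_gibbsWeight_bdgBondHamiltonian_phase` — the single-slice partition function is blind to a
  global pair phase: `Tr e^{-βH_BdG(τ, e^{iθ}Δ, μ)} = Tr e^{-βH_BdG(τ, Δ, μ)}` (gauge covariance,
  through the Trotter determinant formula `Literature/…/BdGZeroModeTrotterDeterminant` at one slice);
* **`norm_trace_prod_gibbsWeight_bdgBondHamiltonian_phase_le`** (DIAMAGNETIC INEQUALITY) —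
  `‖Tr ∏_{t<M} e^{-aH_BdG(τ, e^{iθ_t}Δ, μ)}‖ ≤ Tr e^{-(Ma)H_BdG(τ, Δ, μ)}`, from the trace Hölder
  inequality `…TraceHolder.norm_trace_prod_exp_neg_smul_le` (Simon, *Trace ideals*, Thm. 2.8) and
  the gauge blindness of each slice partition function;
* `norm_trace_prod_gibbsWeight_bdgBondHamiltonian_phase_le_aligned` — the same with the right side
  written as the ALIGNED `M`-slice history `Tr ∏_{t<M} e^{-aH_BdG(τ, Δ, μ)}` (`gibbsWeight_pow`).

So the induced weight of a zero-mode phase history is maximal at alignment (this file, no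
assumption) and, on the torus reference, strictly and extensively smaller off alignment
(`…TorusZeroModeClosedForm`). `Theses`-free, no definitions; `--supports` the crux. [folklore]
-/

noncomputable section

namespace Summit.HubbardSuperconductivity.HubbardSuperconductivity.Theorems

namespace BirBdG

open Matrix NormedSpace Literature.MathematicalPhysics.QuantumLattice
open scoped ComplexOrder

section Diamagnetic

variable {Λ : Type*} [LinearOrder Λ] [Fintype Λ]

/-- **A global pair phase does not change the slice partition function**:
`Tr e^{-βH_BdG(τ, e^{iθ}Δ, μ)} = Tr e^{-βH_BdG(τ, Δ, μ)}` (any `Λ`, `τ`, `Δ`, `μ`, `β`, `θ`).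
[folklore] -/
theorem trace_gibbsWeight_bdgBondHamiltonian_phase (τ Δ : Λ → Λ → ℂ) (μ β θ : ℝ) :
    (Matrix.gibbsWeight β (bdgBondHamiltonian τ (fun x y => Complex.exp (Complex.I * θ) * Δ x y) μ)).trace =
      (Matrix.gibbsWeight β (bdgBondHamiltonian τ Δ μ)).trace := by
  have h1 := trace_prod_gibbsWeight_bdgBondHamiltonian_phase (m := 0) τ Δ μ β (fun _ => θ)
  have h0 := trace_prod_gibbsWeight_bdgBondHamiltonian_phase (m := 0) τ Δ μ β (fun _ => 0)
  simp only [List.ofFn_succ, List.ofFn_zero, List.prod_cons, List.prod_nil, Matrix.mul_one, sub_self,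
    nambuPhase_zero] at h1 h0
  have hΔ : (fun x y => Complex.exp (Complex.I * ((0 : ℝ) : ℂ)) * Δ x y) = Δ := by
    funext x y
    rw [Complex.ofReal_zero, mul_zero, Complex.exp_zero, one_mul]
  rw [hΔ] at h0
  rw [h1, h0]

/-- **Diamagnetic inequality for global pair-phase histories.** For Hermitian hopping `τ`, ANY
pairing `Δ`, `μ`, `a`, and any history of global pair phases over `M = 2^{k+1}` slices,
`‖Tr ∏_{t<M} e^{-aH_BdG(τ, e^{iθ_t}Δ, μ)}‖ ≤ Tr e^{-(Ma)H_BdG(τ, Δ, μ)}`. Simon, *Trace Ideals*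
(2005), Thm. 2.8 (Hölder) + gauge blindness of the slice partition functions.
[cite: Simon2005TraceIdeals, Theorem 2.8] -/
theorem norm_trace_prod_gibbsWeight_bdgBondHamiltonian_phase_le {τ : Λ → Λ → ℂ}
    (hτ : ∀ x y, star (τ x y) = τ y x) (Δ : Λ → Λ → ℂ) (μ a : ℝ) (k : ℕ)
    (θ : Fin (2 ^ (k + 1)) → ℝ) :
    ‖((List.ofFn fun t => Matrix.gibbsWeight a
        (bdgBondHamiltonian τ (fun x y => Complex.exp (Complex.I * θ t) * Δ x y) μ)).prod).trace‖ ≤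
      ((Matrix.gibbsWeight ((2 ^ (k + 1) : ℕ) * a) (bdgBondHamiltonian τ Δ μ)).trace).re := by
  have h := norm_trace_prod_exp_neg_smul_le k a
    (fun t => bdgBondHamiltonian τ (fun x y => Complex.exp (Complex.I * θ t) * Δ x y) μ)
    (fun t => isHermitian_bdgBondHamiltonian hτ _ μ)
  have hslice : ∀ t : Fin (2 ^ (k + 1)),
      ((exp (-((((2 ^ (k + 1) : ℕ) : ℝ) * a : ℝ) : ℂ) •
        bdgBondHamiltonian τ (fun x y => Complex.exp (Complex.I * θ t) * Δ x y) μ)).trace).re =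
        ((Matrix.gibbsWeight ((2 ^ (k + 1) : ℕ) * a) (bdgBondHamiltonian τ Δ μ)).trace).re := fun t => by
    rw [← trace_gibbsWeight_bdgBondHamiltonian_phase τ Δ μ _ (θ t)]
    rfl
  simp only [hslice, Finset.prod_const, Finset.card_univ, Fintype.card_fin] at h
  have hZ : 0 ≤ ((Matrix.gibbsWeight ((2 ^ (k + 1) : ℕ) * a) (bdgBondHamiltonian τ Δ μ)).trace).re := by
    have := re_trace_nonneg_of_posSemidef
      (posDef_gibbsWeight (((2 ^ (k + 1) : ℕ) : ℝ) * a) (isHermitian_bdgBondHamiltonian hτ Δ μ)).posSemidef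
    simpa only [RCLike.re_to_complex] using this
  have hM : ((2 ^ (k + 1) : ℕ) : ℝ) ≠ 0 := by positivity
  rw [← Real.rpow_natCast, ← Real.rpow_mul hZ, one_div, inv_mul_cancel₀ hM, Real.rpow_one] at h
  exact h

/-- **Diamagnetic inequality, aligned form**: the `M`-slice weight of any global pair-phase history
is at most the (real, nonnegative) weight of the ALIGNED history,
`‖Tr ∏_{t<M} e^{-aH_BdG(τ, e^{iθ_t}Δ, μ)}‖ ≤ Tr ∏_{t<M} e^{-aH_BdG(τ, Δ, μ)}`, `M = 2^{k+1}`.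
[cite: Simon2005TraceIdeals, Theorem 2.8] -/
theorem norm_trace_prod_gibbsWeight_bdgBondHamiltonian_phase_le_aligned {τ : Λ → Λ → ℂ}
    (hτ : ∀ x y, star (τ x y) = τ y x) (Δ : Λ → Λ → ℂ) (μ a : ℝ) (k : ℕ)
    (θ : Fin (2 ^ (k + 1)) → ℝ) :
    ‖((List.ofFn fun t => Matrix.gibbsWeight a
        (bdgBondHamiltonian τ (fun x y => Complex.exp (Complex.I * θ t) * Δ x y) μ)).prod).trace‖ ≤
      (((List.ofFn fun _ : Fin (2 ^ (k + 1)) =>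
        Matrix.gibbsWeight a (bdgBondHamiltonian τ Δ μ)).prod).trace).re := by
  rw [List.ofFn_const, List.prod_replicate, gibbsWeight_pow]
  exact norm_trace_prod_gibbsWeight_bdgBondHamiltonian_phase_le hτ Δ μ a k θ

end Diamagnetic

end BirBdG

end Summit.HubbardSuperconductivity.HubbardSuperconductivity.Theorems
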